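import Mathlib
import Summits.ValiantsHypothesis.ValiantsHypothesis.Theorems.BarrierLeverPartitionMinorsHitByVPSimplexJoinTwoSlotsLevels
import Summits.ValiantsHypothesis.ValiantsHypothesis.Theorems.BarrierLeverPartitionMinorsHitByVPSimplexJoinPatternTwoOne
import Summits.ValiantsHypothesis.ValiantsHypothesis.Theorems.BarrierLeverPartitionMinorsHitByVPSimplexJoinPatternOneOne
import Summits.ValiantsHypothesis.ValiantsHypothesis.Theorems.BarrierLeverPartitionMinorsHitByVPHiddenStatesUniversalConstraints

/-!
# Route BarrierLever — item `PartitionMinorsHitByVP` (19717): `Stmt.pieceKill`, shallow pattern (1,0)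
Helper file (`--supports stmt-ValiantsHypothesis-19717`; cell valiant-natproofs, 𝒟-side door (c), line `hidden_states`, uniform-menu
lane; prover seat val-np-p3 gen 12). Definition-free; closes NO item. Fourth SHALLOW case of the case map toward `Stmt.pieceKill H₀`
(memo val-np-p3 g12 §2(g), pattern (P1)): a one-piece exact-support design with a MEDIUM slot (`h+1 ≤ s₁ < 1+h+C(h,2)`) and a NARROW slot
(`1 ≤ s₂ ≤ h`), `n = (s₁+1)(s₂+1)` columns, is defeated for every table (`pieceKill_pattern10`, `h ≥ 2^40`). Leaves (all with ALL rows
small inside `|A| = a` coordinates and deficit `≥ 1`, except the last, a genuine rank form):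
* L2 `6(s₁+1)(s₂+1) ≤ (s₂−3)³`: levels (1,1) inside `a = s₂ − 1`, rows `≤ 3`;
* L3 `⌊√(2s₁)⌋ ≤ s₂`, `7(s₂+1) ≤ s₁`: levels (2,1) inside `a = ⌊√(2s₁)⌋ − 1`, rows `≤ 4` (`arith11_lopsided`, p635932);
* L4 `24(s₁+1)(s₂+1) ≤ (s₂−4)⁴` (and `s₂ < ⌊√(2s₁)⌋`): levels (2,1) inside `a = s₂ − 1`, rows `≤ 4`;
* L5 otherwise (`3(s₂+3) ≤ ⌊√s₁⌋`, `cover10`): levels (2,0) inside `a = ⌊√s₁⌋`, RANK form: `C(a,≤3)` small rows plus the deficit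
  `(s₁+1−C(a,≤2))·s₂` exceed `n` (`arith10_rank`).
Tools: `det_eq_zero_of_two_slots_levels_rank` (p629996), `UniversalConstraints.rowsSmallFirst` (g6), `arith21_pow` (p635134), `arith11_lopsided` (p635932).
-/

set_option linter.dupNamespace false

namespace Summit.ValiantsHypothesis.ValiantsHypothesis.Theorems.BarrierLever.SimplexJoin

open Finset Matrix
open Summit.ValiantsHypothesis.ValiantsHypothesis.Theorems.BarrierLever.HiddenStates.UniversalConstraints
  (rowsSmallFirst rowsSmallFirst_injective card_small_rowsSmallFirst)

/-- Arithmetic of the rank leaf L5: with `a = ⌊√s₁⌋` and `3(s₂+3) ≤ a`, `(s₁+1)(s₂+1) < C(a,≤3) + (s₁+1−C(a,≤2))·s₂`. -/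
theorem arith10_rank (s₁ s₂ a : ℕ) (ha1 : a * a ≤ s₁) (ha2 : s₁ < (a + 1) * (a + 1)) (h3 : 3 * (s₂ + 3) ≤ a) :
    (s₁ + 1) * (s₂ + 1) < ∑ i ∈ Finset.range 4, a.choose i +
      (s₁ + 1 - ∑ i ∈ Finset.range 3, a.choose i) * (s₂ + 1 - ∑ i ∈ Finset.range 1, a.choose i) := by
  obtain ⟨c, rfl⟩ : ∃ c, a = c + 2 := ⟨a - 2, by omega⟩
  have hP2 : 2 * (c + 2).choose 2 = (c + 1) * (c + 2) := by
    have h1 := Nat.descFactorial_eq_factorial_mul_choose (c + 2) 2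
    have h2 : (c + 2).descFactorial 2 = (c + 1) * (c + 2) := by simp [Nat.descFactorial_succ]
    simp only [Nat.factorial_two] at h1
    omega
  have hP3 : 6 * (c + 2).choose 3 = c * (c + 1) * (c + 2) := by
    have h1 := Nat.descFactorial_eq_factorial_mul_choose (c + 2) 3
    have h2 : (c + 2).descFactorial 3 = c * (c + 1) * (c + 2) := by
      simp [Nat.descFactorial_succ]; ring
    rw [h2, show Nat.factorial 3 = 6 by rfl] at h1
    omega
  simp only [Finset.sum_range_succ, Finset.sum_range_zero, Nat.choose_zero_right, Nat.choose_one_right, zero_add]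
  set P2 := (c + 2).choose 2 with hP2def
  set P3 := (c + 2).choose 3 with hP3def
  have hPle : 1 + (c + 2) + P2 ≤ s₁ + 1 := by nlinarith
  set x := s₁ + 1 - (1 + (c + 2) + P2) with hx
  have hxs : s₁ + 1 = x + (1 + (c + 2) + P2) := by omega
  have hs2' : s₂ + 1 - 1 = s₂ := by omega
  rw [hs2', hxs]
  have hxle : 2 * x + (c + 1) * (c + 2) + 2 * (c + 3) ≤ 2 * ((c + 3) * (c + 3)) := by nlinarith
  have h3' : 3 * s₂ + 7 ≤ c := by omega
  have F1 : ((c + 1) * (c + 2) + 2 * (c + 3)) * (3 * s₂ + 7) ≤ ((c + 1) * (c + 2) + 2 * (c + 3)) * c :=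
    Nat.mul_le_mul_left _ h3'
  nlinarith [F1, hxle]

/-- Coverage of the leaves: outside L2–L4 the narrow slot is tiny, `3(s₂+3) ≤ ⌊√s₁⌋` (uses `s₁ ≥ 2^40`). -/
theorem cover10 (s₁ s₂ q a : ℕ) (hs₁ : 2 ^ 40 ≤ s₁) (hq1 : q * q ≤ 2 * s₁) (hq2 : 2 * s₁ < (q + 1) * (q + 1))
    (ha2 : s₁ < (a + 1) * (a + 1))
    (hL2 : (s₂ - 3) ^ 3 < 6 * ((s₁ + 1) * (s₂ + 1)))
    (hL3 : ¬ (q ≤ s₂ ∧ 7 * (s₂ + 1) ≤ s₁))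
    (hL4 : ¬ (s₂ < q ∧ 24 * ((s₁ + 1) * (s₂ + 1)) ≤ (s₂ - 4) ^ 4)) :
    3 * (s₂ + 3) ≤ a := by
  have hq20 : 2 ^ 20 ≤ q + 1 := by nlinarith
  rcases lt_or_ge s₂ q with hlt | hge
  · -- `s₂ < q`: not L4 means `(s₂-4)^4 < 24 (s₁+1)(s₂+1)`
    have hL4' : (s₂ - 4) ^ 4 < 24 * ((s₁ + 1) * (s₂ + 1)) := by
      by_contra hle; exact hL4 ⟨hlt, not_lt.mp hle⟩
    by_contra hlt3
    have ha3 : a + 1 ≤ 3 * s₂ + 9 := by omega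
    have hs₁' : s₁ + 1 ≤ (3 * s₂ + 9) * (3 * s₂ + 9) := (Nat.succ_le_of_lt ha2).trans (Nat.mul_le_mul ha3 ha3)
    rcases lt_or_ge s₂ 600 with hsmall | hbig
    · have : (3 * s₂ + 9) * (3 * s₂ + 9) ≤ 1809 * 1809 := Nat.mul_le_mul (by omega) (by omega)
      omega
    · obtain ⟨w, rfl⟩ : ∃ w, s₂ = w + 4 := ⟨s₂ - 4, by omega⟩
      rw [show w + 4 - 4 = w by omega] at hL4'
      have hw : 596 ≤ w := by omega
      have h1 : 24 * ((s₁ + 1) * (w + 4 + 1)) ≤ 24 * (((3 * (w + 4) + 9) * (3 * (w + 4) + 9)) * (w + 5)) :=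
        Nat.mul_le_mul_left _ (Nat.mul_le_mul_right _ hs₁')
      have G3 : 596 * (w * (w * w)) ≤ w * (w * (w * w)) := Nat.mul_le_mul_right _ hw
      have G4 : 596 * (w * w) ≤ w * (w * w) := Nat.mul_le_mul_right _ hw
      have G5 : 596 * w ≤ w * w := Nat.mul_le_mul_right _ hw
      nlinarith [h1, G3, G4, G5]
  · -- `s₂ ≥ q`: not L3 means `s₁ < 7 (s₂+1)`, and then L2 would hold
    have h7 : s₁ < 7 * (s₂ + 1) := by
      by_contra hle; exact hL3 ⟨hge, not_lt.mp hle⟩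
    exfalso
    obtain ⟨w, rfl⟩ : ∃ w, s₂ = w + 3 := ⟨s₂ - 3, by omega⟩
    rw [show w + 3 - 3 = w by omega] at hL2
    have hw : 2 ^ 19 ≤ w := by omega
    have h1 : 6 * ((s₁ + 1) * (w + 3 + 1)) ≤ 6 * ((7 * (w + 3 + 1)) * (w + 3 + 1)) :=
      Nat.mul_le_mul_left _ (Nat.mul_le_mul_right _ (by omega))
    have G4 : 2 ^ 19 * (w * w) ≤ w * (w * w) := Nat.mul_le_mul_right _ hw
    have G5 : 2 ^ 19 * w ≤ w * w := Nat.mul_le_mul_right _ hw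
    nlinarith [h1, G4, G5]

/-- `C(a,≤2) ≤ s` whenever `(a+1)² ≤ 2s + a + ... `: precisely `a² + a + 2 ≤ 2 s` gives `Σ_{i<3} C(a,i) ≤ s`. -/
theorem sum_choose_three_le_of_sq (a s : ℕ) (h : a * a + a + 2 ≤ 2 * s) : ∑ i ∈ Finset.range 3, a.choose i ≤ s := by
  have h1 := Nat.descFactorial_eq_factorial_mul_choose a 2
  have h2 : a.descFactorial 2 = (a - 1) * a := by simp [Nat.descFactorial_succ]
  simp only [Nat.factorial_two] at h1
  simp only [Finset.sum_range_succ, Finset.sum_range_zero, Nat.choose_zero_right, Nat.choose_one_right, zero_add]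
  rcases Nat.eq_zero_or_pos a with ha | ha
  · subst ha; simp at h1 ⊢; omega
  · obtain ⟨k, rfl⟩ : ∃ k, a = k + 1 := ⟨a - 1, by omega⟩
    rw [show k + 1 - 1 = k by omega] at h2
    have hPQ : (k + 1) * (k + 1) = k * (k + 1) + (k + 1) := by ring
    omega

/-- All rows small inside `|A| = a` coordinates: the generic row family and its two properties. -/
theorem smallRows_props (h a d n : ℕ) (ha : a ≤ h) (hn2a : n ≤ 2 ^ a) (hnC : n ≤ ∑ i ∈ Finset.range (d + 1), a.choose i) :
    Function.Injective (fun i : Fin n => (rowsSmallFirst a (d + 1) n hn2a i).map (Fin.castLEEmb ha)) ∧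
    (Finset.univ.filter fun i : Fin n =>
        (rowsSmallFirst a (d + 1) n hn2a i).map (Fin.castLEEmb ha) ⊆ (Finset.univ : Finset (Fin a)).map (Fin.castLEEmb ha) ∧
        ((rowsSmallFirst a (d + 1) n hn2a i).map (Fin.castLEEmb ha)).card ≤ d) = Finset.univ := by
  classical
  refine ⟨fun i i' hii' => rowsSmallFirst_injective a (d + 1) n hn2a ((Finset.map_injective _) hii'), ?_⟩
  have hall : ∀ i, (rowsSmallFirst a (d + 1) n hn2a i).card < d + 1 := by
    have hsmall := card_small_rowsSmallFirst a (d + 1) n hn2a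
    rw [min_eq_left hnC] at hsmall
    have heq : (Finset.univ.filter fun i : Fin n => (rowsSmallFirst a (d + 1) n hn2a i).card < d + 1) = Finset.univ :=
      Finset.eq_univ_of_card _ (le_antisymm (Finset.card_filter_le _ _ |>.trans (by simp)) (by simpa using hsmall))
    intro i
    have : i ∈ (Finset.univ.filter fun i : Fin n => (rowsSmallFirst a (d + 1) n hn2a i).card < d + 1) := by
      rw [heq]; exact Finset.mem_univ i
    exact (Finset.mem_filter.mp this).2
  refine Finset.eq_univ_of_forall fun i => Finset.mem_filter.mpr ⟨Finset.mem_univ _, ?_, ?_⟩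
  · exact Finset.map_subset_map.mpr (Finset.subset_univ _)
  · have := hall i
    simp only [Finset.card_map]
    omega

/-- Level-2 bookkeeping: `(a+1)² ≤ 2s`, `1 ≤ s` give `a² + a + 2 ≤ 2s`. -/
theorem lev2_of_sq (a s : ℕ) (h1 : (a + 1) * (a + 1) ≤ 2 * s) (h2 : 1 ≤ s) : a * a + a + 2 ≤ 2 * s := by
  rcases a with _ | a
  · omega
  · nlinarith [h1]

/-- `⌊√s⌋ ≥ 30` once `s ≥ 2^40`. -/
theorem sqrt_lb' (b s : ℕ) (hb2 : s < (b + 1) * (b + 1)) (hs : 2 ^ 40 ≤ s) : 30 ≤ b := by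
  nlinarith [hb2, hs]

/-- `⌊√(2s)⌋ ≥ 2^10` once `s ≥ 2^40`. -/
theorem sqrt_lb (q s : ℕ) (hq2 : 2 * s < (q + 1) * (q + 1)) (hs : 2 ^ 40 ≤ s) : 2 ^ 10 ≤ q := by
  nlinarith [hq2, hs]

/-- **Generic all-small two-slot leaf.** Inside `|A| = a ≤ h` coordinates, if all `n` smallest rows have size `≤ m₁+m₂+1`
(`n ≤ C(a, ≤ m₁+m₂+1)`, `n ≤ 2^a`) and the two slots are deep at levels `m₁, m₂` w.r.t. `a`, every table is singular on that row family. -/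
theorem leaf_allSmall (h D N n m₁ m₂ a : ℕ) (S : Fin 1 → Fin D → Finset (Fin N))
    (e : Fin n → Fin 1 × (Fin D → Option (Fin N))) (he : Function.Injective e)
    (hlive : ∀ c : Fin 1 × (Fin D → Option (Fin N)),
      c ∈ Set.range e ↔ ∀ (f : Fin D) (j : Fin N), c.2 f = some j → j ∈ S c.1 f)
    (f₁ f₂ : Fin D) (hf : f₁ ≠ f₂) (ha : a ≤ h) (hn2a : n ≤ 2 ^ a)
    (hnC : n ≤ ∑ i ∈ Finset.range (m₁ + m₂ + 1 + 1), a.choose i)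
    (hlev₁ : ∑ i ∈ Finset.range (m₁ + 1), a.choose i ≤ (S 0 f₁).card)
    (hlev₂ : ∑ i ∈ Finset.range (m₂ + 1), a.choose i ≤ (S 0 f₂).card) :
    ∃ v : Fin n → Finset (Fin h), Function.Injective v ∧
      ∀ T : Fin 1 → Option (Fin D × Fin N) → Fin h → ℂ,
        (Matrix.of fun x x' : Fin n => ∏ a ∈ v x,
          (T (e x').1 none a + ∑ f : Fin D, ((e x').2 f).elim 0 fun j => T (e x').1 (some (f, j)) a)).det = 0 := by
  classical
  obtain ⟨hv, hSmall⟩ := smallRows_props h a (m₁ + m₂ + 1) n ha hn2a hnC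
  refine ⟨_, hv, fun T => ?_⟩
  refine det_eq_zero_of_two_slots_levels_rank h m₁ m₂ 1 D N n ((Finset.univ : Finset (Fin a)).map (Fin.castLEEmb ha)) _
    S e he hlive 0 f₁ f₂ hf ?_ T
  rw [hSmall, Finset.card_univ, Fintype.card_fin, Finset.card_map, Finset.card_univ, Fintype.card_fin]
  have := Nat.mul_le_mul (Nat.le_sub_of_add_le (Nat.add_comm _ _ ▸ Nat.add_le_add_right hlev₁ 1))
    (Nat.le_sub_of_add_le (Nat.add_comm _ _ ▸ Nat.add_le_add_right hlev₂ 1))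
  exact Nat.lt_add_of_pos_right (by rw [one_mul] at this; exact this)

/-- **The rank leaf L5.** Levels (2,0) inside `|A| = b = ⌊√s₁⌋` coordinates with `3(s₂+3) ≤ b`: the `C(b,≤3)` small rows plus the
deficit `(s₁+1−C(b,≤2))·s₂` exceed `n = (s₁+1)(s₂+1)`. -/
theorem leaf_rank20 (h D N n b : ℕ) (S : Fin 1 → Fin D → Finset (Fin N))
    (e : Fin n → Fin 1 × (Fin D → Option (Fin N))) (he : Function.Injective e)
    (hlive : ∀ c : Fin 1 × (Fin D → Option (Fin N)),
      c ∈ Set.range e ↔ ∀ (f : Fin D) (j : Fin N), c.2 f = some j → j ∈ S c.1 f)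
    (f₁ f₂ : Fin D) (hf : f₁ ≠ f₂) (hbh : b ≤ h) (hb30 : 30 ≤ b) (hb1 : b * b ≤ (S 0 f₁).card)
    (hb2 : (S 0 f₁).card < (b + 1) * (b + 1))
    (hs₂ : 1 ≤ (S 0 f₂).card) (h3 : 3 * ((S 0 f₂).card + 3) ≤ b) (hn : n = ((S 0 f₁).card + 1) * ((S 0 f₂).card + 1)) :
    ∃ v : Fin n → Finset (Fin h), Function.Injective v ∧
      ∀ T : Fin 1 → Option (Fin D × Fin N) → Fin h → ℂ,
        (Matrix.of fun x x' : Fin n => ∏ a ∈ v x,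
          (T (e x').1 none a + ∑ f : Fin D, ((e x').2 f).elim 0 fun j => T (e x').1 (some (f, j)) a)).det = 0 := by
  classical
  set s₁ := (S 0 f₁).card with hs₁def
  set s₂ := (S 0 f₂).card with hs₂def
  have hrank := arith10_rank s₁ s₂ b hb1 hb2 h3
  have hn2b : n ≤ 2 ^ b := by
    have h1 := Nat.pow_sub_le_descFactorial b 4
    rw [Nat.descFactorial_eq_factorial_mul_choose, show Nat.factorial 4 = 24 by rfl] at h1
    have h2 := Nat.choose_le_two_pow b 4
    have h4 : 24 * n ≤ (b + 1 - 4) ^ 4 := by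
      obtain ⟨c, hc⟩ : ∃ c, b = c + 3 := ⟨b - 3, by omega⟩
      have hb2' : s₁ + 1 ≤ (c + 4) * (c + 4) := by
        have := Nat.succ_le_of_lt hb2; rw [hc] at this; simpa [add_assoc] using this
      have h3' : 3 * (s₂ + 1) ≤ c := by omega
      rw [hc, show c + 3 + 1 - 4 = c by omega, hn]
      have hc36 : 27 ≤ c := by omega
      have G1 : (s₁ + 1) * (s₂ + 1) ≤ ((c + 4) * (c + 4)) * (s₂ + 1) := Nat.mul_le_mul_right _ hb2'
      have G2 : ((c + 4) * (c + 4)) * (3 * (s₂ + 1)) ≤ ((c + 4) * (c + 4)) * c := Nat.mul_le_mul_left _ h3'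
      have G3 : 27 * (c * c) ≤ c * (c * c) := Nat.mul_le_mul_right _ hc36
      have G4 : 27 * c ≤ c * c := Nat.mul_le_mul_right _ hc36
      clear hb2 h3 hrank hc hb1 hbh hb30
      nlinarith [G1, G2, G3, G4]
    omega
  let emb : Fin b ↪ Fin h := Fin.castLEEmb hbh
  refine ⟨fun i => (rowsSmallFirst b 4 n hn2b i).map emb,
    fun i i' hii' => rowsSmallFirst_injective b 4 n hn2b ((Finset.map_injective emb) hii'), fun T => ?_⟩
  refine det_eq_zero_of_two_slots_levels_rank h 2 0 1 D N n ((Finset.univ : Finset (Fin b)).map emb) _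
    S e he hlive 0 f₁ f₂ hf ?_ T
  have hsmall := card_small_rowsSmallFirst b 4 n hn2b
  have hsub : (Finset.univ.filter fun i : Fin n => (rowsSmallFirst b 4 n hn2b i).card < 4) ⊆
      (Finset.univ.filter fun i : Fin n => (rowsSmallFirst b 4 n hn2b i).map emb ⊆ (Finset.univ : Finset (Fin b)).map emb ∧
        ((rowsSmallFirst b 4 n hn2b i).map emb).card ≤ 2 + 0 + 1) := by
    intro i hi
    simp only [Finset.mem_filter, Finset.mem_univ, true_and] at hi ⊢
    refine ⟨Finset.map_subset_map.mpr (Finset.subset_univ _), ?_⟩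
    rw [Finset.card_map]; omega
  have hcard := Finset.card_le_card hsub
  rw [Finset.card_map, Finset.card_univ, Fintype.card_fin]
  have hx : 1 ≤ (s₁ + 1 - ∑ i ∈ Finset.range 3, b.choose i) * (s₂ + 1 - ∑ i ∈ Finset.range 1, b.choose i) := by
    have hl3 : ∑ i ∈ Finset.range 3, b.choose i ≤ s₁ :=
      sum_choose_three_le_of_sq b s₁ (by nlinarith [hb1, h3])
    have h1 : 1 ≤ s₁ + 1 - ∑ i ∈ Finset.range 3, b.choose i := Nat.le_sub_of_add_le (by omega)
    have h2 : 1 ≤ s₂ + 1 - ∑ i ∈ Finset.range 1, b.choose i := by simp; omega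
    exact Nat.mul_le_mul h1 h2
  rcases le_total n (∑ i ∈ Finset.range 4, b.choose i) with hle | hle
  · rw [min_eq_left hle] at hsmall
    calc n < n + 1 := Nat.lt_succ_self _
      _ ≤ _ := Nat.add_le_add (hsmall.trans hcard) hx
  · rw [min_eq_right hle] at hsmall
    calc n = (s₁ + 1) * (s₂ + 1) := hn
      _ < _ := hrank
      _ ≤ _ := Nat.add_le_add_right (hsmall.trans hcard) _

/-- **Pattern (1,0) of `Stmt.pieceKill`.** A one-piece exact-support design with a medium slot (`h+1 ≤ s₁ < 1+h+C(h,2)`), a narrow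
slot (`1 ≤ s₂ ≤ h`) and `n = (s₁+1)(s₂+1)` columns has an injective row family on which every table is singular (`h ≥ 2^40`). -/
theorem pieceKill_pattern10 (h D N n : ℕ) (hh : 2 ^ 40 ≤ h) (S : Fin 1 → Fin D → Finset (Fin N))
    (e : Fin n → Fin 1 × (Fin D → Option (Fin N))) (he : Function.Injective e)
    (hlive : ∀ c : Fin 1 × (Fin D → Option (Fin N)),
      c ∈ Set.range e ↔ ∀ (f : Fin D) (j : Fin N), c.2 f = some j → j ∈ S c.1 f)
    (f₁ f₂ : Fin D) (hf : f₁ ≠ f₂)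
    (hs₁ : h + 1 ≤ (S 0 f₁).card) (hs₁c : (S 0 f₁).card < ∑ i ∈ Finset.range 3, h.choose i)
    (hs₂ : 1 ≤ (S 0 f₂).card) (hs₂h : (S 0 f₂).card ≤ h)
    (hn : n = ((S 0 f₁).card + 1) * ((S 0 f₂).card + 1)) :
    ∃ v : Fin n → Finset (Fin h), Function.Injective v ∧
      ∀ T : Fin 1 → Option (Fin D × Fin N) → Fin h → ℂ,
        (Matrix.of fun x x' : Fin n => ∏ a ∈ v x,
          (T (e x').1 none a + ∑ f : Fin D, ((e x').2 f).elim 0 fun j => T (e x').1 (some (f, j)) a)).det = 0 := by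
  classical
  set s₁ := (S 0 f₁).card with hs₁def
  set s₂ := (S 0 f₂).card with hs₂def
  -- `2·C(h,≤2) = h² + h + 2`
  have hc₂ : 2 * ∑ i ∈ Finset.range 3, h.choose i = h * h + h + 2 := by
    have h1 := Nat.descFactorial_eq_factorial_mul_choose h 2
    have h2 : h.descFactorial 2 = (h - 1) * h := by simp [Nat.descFactorial_succ]
    simp only [Nat.factorial_two] at h1
    simp only [Finset.sum_range_succ, Finset.sum_range_zero, Nat.choose_zero_right, Nat.choose_one_right, zero_add]
    obtain ⟨k, rfl⟩ : ∃ k, h = k + 1 := ⟨h - 1, by omega⟩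
    rw [show k + 1 - 1 = k by omega] at h2
    nlinarith [h1, h2]
  -- the two integer square roots
  obtain ⟨q, hq1, hq2⟩ : ∃ q, q * q ≤ 2 * s₁ ∧ 2 * s₁ < (q + 1) * (q + 1) :=
    ⟨Nat.sqrt (2 * s₁), Nat.sqrt_le _, Nat.lt_succ_sqrt _⟩
  obtain ⟨b, hb1, hb2⟩ : ∃ b, b * b ≤ s₁ ∧ s₁ < (b + 1) * (b + 1) := ⟨Nat.sqrt s₁, Nat.sqrt_le _, Nat.lt_succ_sqrt _⟩
  have hqh : q ≤ h := by
    have : q * q < (h + 1) * (h + 1) := by nlinarith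
    exact Nat.lt_succ_iff.mp (Nat.mul_self_lt_mul_self_iff.mp this)
  have hbh : b ≤ h := by
    have : b * b < (h + 1) * (h + 1) := by nlinarith
    exact Nat.lt_succ_iff.mp (Nat.mul_self_lt_mul_self_iff.mp this)
  by_cases hL2 : (s₂ - 3) ^ 3 < 6 * ((s₁ + 1) * (s₂ + 1))
  swap
  · -- L2: levels (1,1) inside `a = s₂ - 1`, rows ≤ 3
    push Not at hL2
    have ha : s₂ - 1 ≤ h := by omega
    have hnC3 : n ≤ (s₂ - 1).choose 3 := by
      have h1 := Nat.pow_sub_le_descFactorial (s₂ - 1) 3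
      rw [Nat.descFactorial_eq_factorial_mul_choose, show Nat.factorial 3 = 6 by rfl,
        show s₂ - 1 + 1 - 3 = s₂ - 3 by omega] at h1
      have : 6 * n ≤ 6 * (s₂ - 1).choose 3 := by rw [hn]; exact hL2.trans h1
      omega
    refine leaf_allSmall h D N n 1 1 (s₂ - 1) S e he hlive f₁ f₂ hf ha (hnC3.trans (Nat.choose_le_two_pow _ 3))
      (hnC3.trans (Finset.single_le_sum (f := fun i => (s₂ - 1).choose i) (fun i _ => Nat.zero_le _)
        (Finset.mem_range.mpr (by norm_num)))) ?_ ?_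
    · simp [Finset.sum_range_succ]; omega
    · simp [Finset.sum_range_succ]; omega
  by_cases hL3 : q ≤ s₂ ∧ 7 * (s₂ + 1) ≤ s₁
  · -- L3: levels (2,1) inside `a = q - 1`, rows ≤ 4
    obtain ⟨hqs, h7⟩ := hL3
    have hq10 : 2 ^ 10 ≤ q := sqrt_lb q s₁ hq2 (by omega)
    have ha : q - 1 ≤ h := by omega
    have hnC4 : n ≤ (q - 1).choose 4 := by
      have h1 := Nat.pow_sub_le_descFactorial (q - 1) 4
      rw [Nat.descFactorial_eq_factorial_mul_choose, show Nat.factorial 4 = 24 by rfl,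
        show q - 1 + 1 - 4 = q - 4 by omega] at h1
      have : 24 * n ≤ 24 * (q - 1).choose 4 := by rw [hn]; exact (arith11_lopsided s₁ s₂ q hq10 hq1 hq2 h7).trans h1
      omega
    refine leaf_allSmall h D N n 2 1 (q - 1) S e he hlive f₁ f₂ hf ha (hnC4.trans (Nat.choose_le_two_pow _ 4))
      (hnC4.trans (Finset.single_le_sum (f := fun i => (q - 1).choose i) (fun i _ => Nat.zero_le _)
        (Finset.mem_range.mpr (by norm_num)))) ?_ ?_
    · exact sum_choose_three_le_of_sq (q - 1) s₁
        (lev2_of_sq (q - 1) s₁ (by rw [show q - 1 + 1 = q by omega]; exact hq1) (by omega))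
    · simp [Finset.sum_range_succ]; omega
  by_cases hL4 : s₂ < q ∧ 24 * ((s₁ + 1) * (s₂ + 1)) ≤ (s₂ - 4) ^ 4
  · -- L4: levels (2,1) inside `a = s₂ - 1`, rows ≤ 4
    obtain ⟨hsq, h24⟩ := hL4
    have ha : s₂ - 1 ≤ h := by omega
    have hnC4 : n ≤ (s₂ - 1).choose 4 := by
      have h1 := Nat.pow_sub_le_descFactorial (s₂ - 1) 4
      rw [Nat.descFactorial_eq_factorial_mul_choose, show Nat.factorial 4 = 24 by rfl,
        show s₂ - 1 + 1 - 4 = s₂ - 4 by omega] at h1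
      have : 24 * n ≤ 24 * (s₂ - 1).choose 4 := by rw [hn]; exact h24.trans h1
      omega
    refine leaf_allSmall h D N n 2 1 (s₂ - 1) S e he hlive f₁ f₂ hf ha (hnC4.trans (Nat.choose_le_two_pow _ 4))
      (hnC4.trans (Finset.single_le_sum (f := fun i => (s₂ - 1).choose i) (fun i _ => Nat.zero_le _)
        (Finset.mem_range.mpr (by norm_num)))) ?_ ?_
    · exact sum_choose_three_le_of_sq (s₂ - 1) s₁
        (lev2_of_sq (s₂ - 1) s₁ (by rw [show s₂ - 1 + 1 = s₂ by omega]; exact (Nat.mul_le_mul hsq.le hsq.le).trans hq1)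
          (by omega))
    · simp [Finset.sum_range_succ]; omega
  · -- L5: levels (2,0) inside `b = ⌊√s₁⌋`, RANK form
    have h3 : 3 * (s₂ + 3) ≤ b := cover10 s₁ s₂ q b (by omega) hq1 hq2 hb2 hL2 hL3 hL4
    exact leaf_rank20 h D N n b S e he hlive f₁ f₂ hf hbh (sqrt_lb' b s₁ hb2 (by omega)) hb1 hb2 hs₂ h3 hn

end Summit.ValiantsHypothesis.ValiantsHypothesis.Theorems.BarrierLever.SimplexJoin
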